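import Summits.HodgeConjecture.CorCM.AndreProductFormGalois
import Summits.HodgeConjecture.HodgeConjecture.Theorems.PadicSemiregularLiftHodgeAbelianVarietiesAndrePowerHOne
import Literature.AlgebraicGeometry.Milne1999.CMHodgeHypothesisFromCMTypedProducts
import Literature.AlgebraicGeometry.HodgeTheory.WeilClassesMoonenZarhinCriterionHolds
import Literature.AlgebraicGeometry.HodgeTheory.WeilClassesCyclicPrymDimension
import Literature.AlgebraicGeometry.HodgeTheory.AbelJacobiPullbackHodgeSection
import Literature.NumberTheory.Automorphic.PicardCMEigenbasis
import Literature.AlgebraicGeometry.Pohlmann1968.HodgeClassesCMTypeProducts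
import HarnessLib

/-!
# COR-CM (cell `pub-hodgecm2`), André 1992 in product form — part 2: `H¹` of a finite biproduct of
# CM-typed realisations, and the Moonen–Zarhin vanishing on NON-admissible products

HONEST FRAMING (cell pub-hodgecm2 / COR-CM, literature seat André): structure lemmas on the tree's real
carriers for the kernel proof of `HodgeTheory.Andre1992_hodgeClasses_cmTypedProduct_mem_span_pullback_weilLines`
(file `CorCM/AndreProductFormHolds.lean`); no case of the Hodge conjecture is proved and nothing about
algebraic cycles is asserted. Contents (all PROVED):

* eigenbases of `H¹` of a CM-typed realisation `(A, ι, θ)` of `(K; Φ)` (`exists_eigenbasis`, from the tree's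
  `exists_basis_mem_eigenline`), the action `ι(a)^* = σ(a)` on the `σ`-line, the Hodge types `(1,0)`/`(0,1)`
  of the lines in the `A.dim` normalisation, and transport of eigenbases along `e ∈ Aut K`;
* `H¹(⨁_j A_j)` has the basis `(π j)^* (v j i)` built from bases of the factors (`biprodBasis`, a choice
  of the basis of the tree's `Pohlmann1968.exists_biproductBasis`; Lange–Birkenhake §1.1),
  whence `2 dim (⨁ A) = #J · #I`;
* DEGREE ZERO of André's statement (`andre_productForm_zero`): every self-map of a smooth projective variety
  is the identity on `H⁰ = ℂ·1` (`complexBetti_map_zero_hom_eq_id`);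
* **`eq_zero_of_not_admissible`**: on a product `⨁_{j<2p} B_j` of realisations of CM types `Ψ_j` of `K`
  whose indicator sum `s ↦ #{j : s ∈ Ψ_j}` is NOT constantly `p`, every rational `(p,p)` class of the
  `K`-Weil-line space `⨆_s ⨅_a ker((act a)^* − s(a)^{2p})` vanishes — Moonen–Zarhin's criterion (ii), i.e.
  the tree's DISCHARGED `eq_zero_of_mem_weilClassesField_of_unbalanced` for `F = ℚ(a₀)`, with the
  multiplicities `n_{s(a₀)} = #{j : s ∈ Ψ_j}` read off the `(1,0)`-lines (`card_filter_le_eigenMultiplicity`,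
  `n_ρ + n_ρ̄ = 2p`) and `#{j : s̄ ∈ Ψ_j} + #{j : s ∈ Ψ_j} = 2p` (CM types).

## References
* [MoonenZarhin1998WeilClasses] B. Moonen, Yu. Zarhin, J. reine angew. Math. 496 (1998), §1 (Criterion, `n_σ`).
* [CharlesSchnell2014Notes] F. Charles, C. Schnell, *Notes on absolute Hodge classes* (2014), Prop. 11.5.20, Prop. 11.5.22.
* [LangeBirkenhake1992] H. Lange, Ch. Birkenhake, *Complex Abelian Varieties* (1992), §1.1 (p. 19).
* [HatcherAT2002] A. Hatcher, *Algebraic Topology* (2002), §3.1 p. 199 (`H⁰`).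
-/

noncomputable section

namespace Summit.HodgeConjecture.CorCM.AndreProductForm

open NumberField

variable (K : Type) [Field K] [NumberField K]

/-! ## Eigenbases of CM-typed realisations -/

section Realisation

open CategoryTheory CategoryTheory.Limits
open Literature.AlgebraicGeometry Literature.AlgebraicGeometry.Motives Literature.AlgebraicGeometry.HodgeTheory
open Literature.AlgebraicGeometry.ComplexMultiplication
open Literature.NumberTheory.Automorphic.PicardCM (eigenline)
open Summit.HodgeConjecture.HodgeConjecture.Theorems.HodgeAbelianVarieties.CMPivotAndre

variable {K}
variable {Φ : CMType K} {A : AbelianVariety ℂ} {ι : 𝓞 K →+* End A}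
  {θ : K →+* Module.End ℂ (complexBetti A.X 1)}

/-- An eigenbasis of `H¹` of a realisation, indexed by the complex embeddings. [folklore] -/
theorem exists_eigenbasis (h : IsCMTypeRealisation Φ A ι θ) :
    ∃ v : Module.Basis (K →+* ℂ) ℂ (complexBetti A.X 1), ∀ σ, v σ ∈ eigenline θ σ :=
  exists_basis_mem_eigenline θ h.2.1 fun σ => (h.2.2.2 σ).1

/-- On a `σ`-eigenvector, `ι(a)^*` is the scalar `σ(a)`. [folklore] -/
theorem map_ι_apply_of_mem_eigenline (h : IsCMTypeRealisation Φ A ι θ) {v : complexBetti A.X 1}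
    {σ : K →+* ℂ} (hv : v ∈ eigenline θ σ) (a : 𝓞 K) :
    complexBetti.map (ι a).hom.hom.hom 1 v = σ (a : K) • v := by
  have h1 : (complexBetti.map (ι a).hom.hom.hom 1).hom = θ (a : K) := h.2.2.1 a
  change (complexBetti.map (ι a).hom.hom.hom 1).hom v = _
  rw [h1]
  exact eigenline_apply_eq_smul hv (a : K)

/-- `dim A = [K:ℚ]/2` for a realisation. [folklore] -/
theorem dim_eq_of_isCMTypeRealisation (h : IsCMTypeRealisation Φ A ι θ) :
    A.dim = Module.finrank ℚ K / 2 :=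
  Motives.schemeDim_eq_holds h.1

/-- Hodge type `(1,0)` of the `σ`-eigenvectors for `σ ∈ Φ`, in the `A.dim` normalisation. [folklore] -/
theorem isOfHodgeType_oneZero_of_mem (h : IsCMTypeRealisation Φ A ι θ) {v : complexBetti A.X 1}
    {σ : K →+* ℂ} (hv : v ∈ eigenline θ σ) (hσ : σ ∈ Φ.1) : IsOfHodgeType A.dim A.X 1 1 0 v := by
  rw [dim_eq_of_isCMTypeRealisation h]
  exact (h.2.2.2 σ).2.1 hσ v hv

/-- Hodge type `(0,1)` of the `σ`-eigenvectors for `σ ∉ Φ`, in the `A.dim` normalisation. [folklore] -/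
theorem isOfHodgeType_zeroOne_of_not_mem (h : IsCMTypeRealisation Φ A ι θ) {v : complexBetti A.X 1}
    {σ : K →+* ℂ} (hv : v ∈ eigenline θ σ) (hσ : σ ∉ Φ.1) : IsOfHodgeType A.dim A.X 1 0 1 v := by
  rw [dim_eq_of_isCMTypeRealisation h]
  exact (h.2.2.2 σ).2.2 hσ v hv

end Realisation

/-! ## `H¹` of a finite biproduct of abelian varieties -/

section Biproduct

open CategoryTheory CategoryTheory.Limits
open Literature.AlgebraicGeometry Literature.AlgebraicGeometry.Motives Literature.AlgebraicGeometry.HodgeTheory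
open Summit.HodgeConjecture.HodgeConjecture.Theorems.HodgeAbelianVarieties.CMPivotAndre

variable {J : Type} [Fintype J] (A : J → AbelianVariety ℂ)

variable {I : Type} [Fintype I] (v : ∀ j, Module.Basis I ℂ (complexBetti (A j).X 1))

/-- **Basis of `H¹` of a finite biproduct** from bases of the factors, `(π j)^* (v j i)`: a choice of
the basis provided by the tree's `Pohlmann1968.exists_biproductBasis` (Künneth in degree one; apply
`(ι j)^*` for independence, `𝟙 = Σ π j ≫ ι j` for spanning). [cite: LangeBirkenhake1992, §1.1 (p. 19)] -/
def biprodBasis : Module.Basis (J × I) ℂ (complexBetti (⨁ A).X 1) :=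
  (Pohlmann1968.exists_biproductBasis A v).choose

/-- Unfolding of `biprodBasis`. [folklore] -/
@[simp]
theorem biprodBasis_apply (p : J × I) :
    biprodBasis A v p = complexBetti.map (biproduct.π A p.1).hom.hom.hom 1 (v p.1 p.2) :=
  (Pohlmann1968.exists_biproductBasis A v).choose_spec p

/-- `dim H¹(⨁ A) = #J · #I`, hence `2 dim (⨁ A) = #J · #I`. [folklore] -/
theorem two_mul_dim_biproduct (v : ∀ j, Module.Basis I ℂ (complexBetti (A j).X 1)) :
    2 * (⨁ A).dim = Fintype.card J * Fintype.card I := by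
  rw [← AbelianVariety.finrank_complexBetti_one, Module.finrank_eq_card_basis (biprodBasis A v),
    Fintype.card_prod]

end Biproduct


/-! ## Transport of eigenbases and the degree-zero case -/

section TransportAndZero

open CategoryTheory CategoryTheory.Limits
open Literature.AlgebraicGeometry Literature.AlgebraicGeometry.Motives Literature.AlgebraicGeometry.HodgeTheory
open Literature.AlgebraicGeometry.ComplexMultiplication
open Literature.NumberTheory.Automorphic (PicardCM.CMCode.cmTypeMap)
open Literature.NumberTheory.Automorphic.PicardCM (eigenline)

omit [NumberField K] in
/-- For a realisation transported along `e`, an eigenbasis of the transported action. [folklore] -/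
theorem exists_eigenbasis_transport {A : AbelianVariety ℂ}
    {θ : K →+* Module.End ℂ (complexBetti A.X 1)} (v : Module.Basis (K →+* ℂ) ℂ (complexBetti A.X 1))
    (hv : ∀ σ, v σ ∈ eigenline θ σ) (e : K ≃+* K) :
    ∃ v' : Module.Basis (K →+* ℂ) ℂ (complexBetti A.X 1), ∀ σ, v' σ ∈ eigenline (θ.comp e.symm.toRingHom) σ := by
  let eq : (K →+* ℂ) ≃ (K →+* ℂ) :=
    { toFun := fun τ => τ.comp e.symm.toRingHom
      invFun := fun σ => σ.comp e.toRingHom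
      left_inv := fun τ => by ext x; simp
      right_inv := fun σ => by ext x; simp }
  refine ⟨v.reindex eq, fun σ => ?_⟩
  rw [Module.Basis.reindex_apply, eigenline_comp_symm]
  exact hv _

/-- **Degree zero**: a rational class in `H⁰(⨁ A)` is the pull-back of a rational class on the empty slot
product (every self-map of a smooth projective variety acts trivially on `H⁰ = ℂ·1`). [folklore] -/
theorem andre_productForm_zero {n : ℕ} (A : Fin n → AbelianVariety ℂ) (Φ : Fin n → CMType K)
    (ι : ∀ i, 𝓞 K →+* End (A i))
    (c : complexBetti (⨁ A).X (2 * 0)) (hc : IsRationalClass c) :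
    c ∈ Submodule.span ℂ
      {c' : complexBetti (⨁ A).X (2 * 0) |
        ∃ (i : Fin (2 * 0) → Fin n) (e : Fin (2 * 0) → (K ≃+* K))
          (t : complexBetti (⨁ fun j => A (i j)).X (2 * 0)),
          Function.Injective (fun j => (i j, e j)) ∧
          (∀ s : K →+* ℂ, {j : Fin (2 * 0) | s ∈ (PicardCM.CMCode.cmTypeMap (e j) (Φ (i j))).1}.ncard = 0) ∧
          IsRationalClass t ∧
          IsOfHodgeType (⨁ fun j => A (i j)).dim (⨁ fun j => A (i j)).X (2 * 0) 0 0 t ∧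
          t ∈ (⨆ s : K →+* ℂ, ⨅ a : 𝓞 K, Module.End.eigenspace (complexBetti.map
            (biproduct.map fun j => ((ι (i j)).comp (RingOfIntegers.mapRingEquiv (e j).symm).toRingHom) a
              : (⨁ fun j => A (i j)) ⟶ ⨁ fun j => A (i j)).hom.hom.hom (2 * 0)).hom ((s a) ^ (2 * 0))) ∧
          c' = complexBetti.map (biproduct.lift fun j => biproduct.π A (i j) :
            (⨁ A) ⟶ ⨁ fun j => A (i j)).hom.hom.hom (2 * 0) t} := by
  classical
  let i : Fin (2 * 0) → Fin n := fun j => False.elim (by have := j.isLt; omega)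
  let e : Fin (2 * 0) → (K ≃+* K) := fun j => False.elim (by have := j.isLt; omega)
  let Z : AbelianVariety ℂ := ⨁ fun j => A (i j)
  let f : (⨁ A) ⟶ Z := biproduct.lift fun j => biproduct.π A (i j)
  let z : Z ⟶ ⨁ A := 0
  have hZ : IsSmoothProjective Z.dim Z.X := AbelianVariety.isSmoothProjective_holds
  have hB : IsSmoothProjective (⨁ A).dim (⨁ A).X := AbelianVariety.isSmoothProjective_holds
  let t : complexBetti Z.X (2 * 0) := complexBetti.map z.hom.hom.hom (2 * 0) c
  obtain ⟨s₀⟩ := (inferInstance : Nonempty (K →+* ℂ))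
  apply Submodule.subset_span
  refine ⟨i, e, t, fun j => False.elim (by have := j.isLt; omega), fun s => ?_, hc.pullback _,
    isOfHodgeType_zero_zero_of_degree_zero hZ t, ?_, ?_⟩
  · rw [Set.ncard_eq_zero]
    ext j
    exact False.elim (by have := j.isLt; omega)
  · refine Submodule.mem_iSup_of_mem s₀ ((Submodule.mem_iInf _).mpr fun a => ?_)
    rw [Module.End.mem_eigenspace_iff, pow_zero, one_smul,
      complexBetti_map_zero_hom_eq_id hZ, LinearMap.id_apply]
  · change c = (complexBetti.map f.hom.hom.hom (2 * 0)) (complexBetti.map z.hom.hom.hom (2 * 0) c)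
    rw [← CategoryTheory.comp_apply, ← complexBetti_map_comp_hom]
    change c = (complexBetti.map (f ≫ z).hom.hom.hom 0).hom c
    rw [complexBetti_map_zero_hom_eq_id hB, LinearMap.id_apply]


end TransportAndZero

/-! ## Rational `(p,p)` `K`-Weil-line classes on a NON-admissible product vanish
(Moonen–Zarhin criterion (ii), the tree's `eq_zero_of_mem_weilClassesField_of_unbalanced`) -/

section Admissible

open CategoryTheory CategoryTheory.Limits Polynomial
open Literature.AlgebraicGeometry Literature.AlgebraicGeometry.Motives Literature.AlgebraicGeometry.HodgeTheory
open Literature.AlgebraicGeometry.ComplexMultiplication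
open Literature.NumberTheory.Automorphic.PicardCM (eigenline cmType_notMem_iff)
open Summit.HodgeConjecture.HodgeConjecture.Theorems.HodgeAbelianVarieties.CMPivotAndre

variable {d : ℕ} (B : Fin d → AbelianVariety ℂ) (act : ∀ j, 𝓞 K →+* End (B j))
variable {θB : ∀ j, K →+* Module.End ℂ (complexBetti (B j).X 1)} {Ψ : Fin d → CMType K}
variable {vB : ∀ j, Module.Basis (K →+* ℂ) ℂ (complexBetti (B j).X 1)}

/-- The line `(j, σ)` of `H¹(⨁ B)` is a `σ(a)`-eigenvector of the diagonal action of `a`. [folklore] -/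
theorem map_diagHom_biprodBasis (hB : ∀ j, IsCMTypeRealisation (Ψ j) (B j) (act j) (θB j))
    (hvB : ∀ j σ, vB j σ ∈ eigenline (θB j) σ) (a : 𝓞 K) (j : Fin d) (σ : K →+* ℂ) :
    complexBetti.map (diagHom K B act a).hom.hom.hom 1 (biprodBasis B vB (j, σ)) =
      σ (a : K) • biprodBasis B vB (j, σ) := by
  rw [biprodBasis_apply]
  change complexBetti.map (diagHom K B act a).hom.hom.hom 1
    (complexBetti.map (biproduct.π B j).hom.hom.hom 1 (vB j σ)) = _
  rw [complexBetti_map_map_one_apply, diagHom, biproduct.map_π, ← complexBetti_map_map_one_apply,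
    map_ι_apply_of_mem_eigenline (hB j) (hvB j σ), map_smul]

/-- The line `(j, σ)` is of type `(1,0)` on `⨁ B` when `σ ∈ Ψ_j`. [folklore] -/
theorem biprodBasis_mem_hodgeOneZero (hB : ∀ j, IsCMTypeRealisation (Ψ j) (B j) (act j) (θB j))
    (hvB : ∀ j σ, vB j σ ∈ eigenline (θB j) σ) {j : Fin d} {σ : K →+* ℂ} (hσ : σ ∈ (Ψ j).1) :
    biprodBasis B vB (j, σ) ∈ hodgeOneZero (AbelianVariety.isSmoothProjective_holds (A := ⨁ B)) := by
  rw [mem_hodgeOneZero, biprodBasis_apply]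
  exact (isOfHodgeType_oneZero_of_mem (hB j) (hvB j σ) hσ).map_of_isSmoothProjective
    AbelianVariety.isSmoothProjective_holds AbelianVariety.isSmoothProjective_holds _

open scoped Classical in
/-- **Lower bound for the multiplicity**: `n_{s(a₀)} ≥ #{j : s ∈ Ψ_j}`. [cite: MoonenZarhin1998WeilClasses, §1 (n_σ)] -/
theorem card_filter_le_eigenMultiplicity (hB : ∀ j, IsCMTypeRealisation (Ψ j) (B j) (act j) (θB j))
    (hvB : ∀ j σ, vB j σ ∈ eigenline (θB j) σ) (a₀ : 𝓞 K) (s : K →+* ℂ) :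
    (Finset.univ.filter fun j : Fin d => s ∈ (Ψ j).1).card ≤
      eigenMultiplicity (⨁ B) (diagHom K B act a₀) (s (a₀ : K)) := by
  haveI := finite_complexBetti_abelianVariety (⨁ B) 1
  set W := Module.End.eigenspace (complexBetti.map (diagHom K B act a₀).hom.hom.hom 1).hom (s (a₀ : K)) ⊓
    hodgeOneZero (AbelianVariety.isSmoothProjective_holds (A := ⨁ B)) with hW
  set Jp := {j : Fin d // s ∈ (Ψ j).1}
  have hmem : ∀ j : Jp, biprodBasis B vB (j.1, s) ∈ W := fun j =>
    ⟨Module.End.mem_eigenspace_iff.mpr (map_diagHom_biprodBasis K B act hB hvB a₀ j.1 s),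
      biprodBasis_mem_hodgeOneZero K B act hB hvB j.2⟩
  let f : Jp → W := fun j => ⟨biprodBasis B vB (j.1, s), hmem j⟩
  have hf : LinearIndependent ℂ f := by
    apply LinearIndependent.of_comp W.subtype
    have : (W.subtype ∘ f) = (biprodBasis B vB) ∘ (fun j : Jp => (j.1, s)) := rfl
    rw [this]
    exact (biprodBasis B vB).linearIndependent.comp _ fun j j' h => Subtype.ext (Prod.mk.inj h).1
  have hcard := hf.fintype_card_le_finrank
  rw [Fintype.card_subtype] at hcard
  exact hcard

omit [NumberField K] in
open scoped Classical in
/-- CM types: `#{j : s̄ ∈ Ψ_j} + #{j : s ∈ Ψ_j} = d`. [folklore] -/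
theorem card_filter_conjugate (Ψ : Fin d → CMType K) (s : K →+* ℂ) :
    (Finset.univ.filter fun j : Fin d => NumberField.ComplexEmbedding.conjugate s ∈ (Ψ j).1).card +
      (Finset.univ.filter fun j : Fin d => s ∈ (Ψ j).1).card = d := by
  have h : (Finset.univ.filter fun j : Fin d => NumberField.ComplexEmbedding.conjugate s ∈ (Ψ j).1) =
      Finset.univ.filter fun j : Fin d => ¬ s ∈ (Ψ j).1 := by
    ext j
    simp only [Finset.mem_filter, Finset.mem_univ, true_and]
    exact (cmType_notMem_iff (Ψ j) s).symm
  rw [h, add_comm, Finset.card_filter_add_card_filter_not, Finset.card_univ, Fintype.card_fin]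

open scoped Classical in
/-- **Rational `(p,p)` classes in the `K`-Weil-line space of a NON-admissible product of realisations
vanish** (Moonen–Zarhin criterion (ii) on the carriers, the tree's
`eq_zero_of_mem_weilClassesField_of_unbalanced`, with `n_{s(a₀)} = #{j : s ∈ Ψ_j}`).
[cite: MoonenZarhin1998WeilClasses, §1 (Criterion)] [cite: CharlesSchnell2014Notes, Prop. 11.5.22] -/
theorem eq_zero_of_not_admissible {p : ℕ} (hd : d = 2 * p)
    (hB : ∀ j, IsCMTypeRealisation (Ψ j) (B j) (act j) (θB j))
    (hvB : ∀ j σ, vB j σ ∈ eigenline (θB j) σ)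
    (a₀ : 𝓞 K) (hsep : Function.Injective fun σ : K →+* ℂ => σ (a₀ : K))
    (hnot : ¬ ∀ s : K →+* ℂ, (Finset.univ.filter fun j : Fin d => s ∈ (Ψ j).1).card = p)
    {t : complexBetti (⨁ B).X (2 * p)}
    (htW : t ∈ ⨆ s : K →+* ℂ, ⨅ a : 𝓞 K,
      Module.End.eigenspace (complexBetti.map (diagHom K B act a).hom.hom.hom (2 * p)).hom ((s a) ^ (2 * p)))
    (htQ : IsRationalClass t) (htH : IsOfHodgeType (⨁ B).dim (⨁ B).X (2 * p) p p t) : t = 0 := by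
  obtain ⟨hPm, hPirr, hPe, hroot, hPa₀⟩ := minpoly_facts K a₀ hsep
  -- `P(φ) = 0`
  have hφP : Polynomial.eval₂ (Int.castRingHom (CategoryTheory.End (⨁ B))) (diagHom K B act a₀ : CategoryTheory.End (⨁ B))
      (minpoly ℤ a₀) = 0 := by
    change Polynomial.eval₂ _ (diagEnd K B act a₀) _ = 0
    rw [eval₂_diagEnd, hPa₀, map_zero]
  -- `e · 2p = 2 dim`
  have her : Module.finrank ℚ K * (2 * p) = 2 * (⨁ B).dim := by
    rw [two_mul_dim_biproduct B vB, Fintype.card_fin, hd, ← NumberField.Embeddings.card K ℂ, mul_comm]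
  -- multiplicities
  have hmult : ∀ s : K →+* ℂ, eigenMultiplicity (⨁ B) (diagHom K B act a₀) (s (a₀ : K)) =
      (Finset.univ.filter fun j : Fin d => s ∈ (Ψ j).1).card := by
    intro s
    have h1 := card_filter_le_eigenMultiplicity K B act hB hvB a₀ s
    have h2 := card_filter_le_eigenMultiplicity K B act hB hvB a₀ (NumberField.ComplexEmbedding.conjugate s)
    rw [NumberField.ComplexEmbedding.conjugate_coe_eq] at h2
    have h3 := card_filter_conjugate K Ψ s
    have hsum := eigenMultiplicity_add_eigenMultiplicity_conj_eq hPm hPe hPirr hφP her (hroot s)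
    omega
  -- an unbalanced root
  have hunb : ∃ ρ : ℂ, Polynomial.eval₂ (Int.castRingHom ℂ) ρ (minpoly ℤ a₀) = 0 ∧
      eigenMultiplicity (⨁ B) (diagHom K B act a₀) ρ ≠ eigenMultiplicity (⨁ B) (diagHom K B act a₀) (starRingEnd ℂ ρ) := by
    obtain ⟨s, hs⟩ := not_forall.mp hnot
    refine ⟨s (a₀ : K), hroot s, ?_⟩
    rw [← NumberField.ComplexEmbedding.conjugate_coe_eq, hmult, hmult]
    have h3 := card_filter_conjugate K Ψ s
    omega
  -- the `K`-Weil lines lie in `W_F ⊗ ℂ` for `F = ℚ(a₀)`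
  have hle : (⨆ s : K →+* ℂ, ⨅ a : 𝓞 K, Module.End.eigenspace
      (complexBetti.map (diagHom K B act a).hom.hom.hom (2 * p)).hom ((s a) ^ (2 * p))) ≤
      weilClassesField (⨁ B) (diagHom K B act a₀) (minpoly ℤ a₀) (2 * p) := by
    refine iSup_le fun s => ?_
    refine le_trans ?_ (pullbackEigenclasses_le_weilClassesField (hroot s))
    intro x hx
    rw [mem_pullbackEigenclasses_iff]
    intro x' y'
    have hx' := (Submodule.mem_iInf _).mp hx ((x' : 𝓞 K) + (y' : 𝓞 K) * a₀)
    rw [Module.End.mem_eigenspace_iff] at hx'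
    rw [nsmul_id_add_nsmul_diagHom]
    change (complexBetti.map (diagHom K B act ((x' : 𝓞 K) + (y' : 𝓞 K) * a₀)).hom.hom.hom (2 * p)).hom x = _
    rw [hx']
    congr 1
    simp
  have htW' : t ∈ weilClassesField (⨁ B) (diagHom K B act a₀) (minpoly ℤ a₀) (2 * p) := hle htW
  have htH' : IsOfHodgeType (⨁ B).dim (⨁ B).X (2 * p) (2 * p / 2) (2 * p / 2) t := by
    rw [Nat.mul_div_cancel_left p (by norm_num)]
    exact htH
  exact eq_zero_of_mem_weilClassesField_of_unbalanced hPm hPe hPirr hφP her hunb htW' htQ htH'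

end Admissible



end Summit.HodgeConjecture.CorCM.AndreProductForm
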